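import Literature.MathematicalPhysics.QuantumFieldTheory.OSSkeletonDensity
import HarnessLib

/-!
# Joint analyticity in logarithmic variables from holomorphic slots (the generic Osterwalder–Schrader Ch. V engine)

Topic `Literature/MathematicalPhysics/QuantumFieldTheory`; the generic form of `OSSkeletonAnalyticity` and
`OSSkeletonDensity` (whose weights `logW`, substitution `expPi`/`integral_comp_exp_pi` and separation
lemma are reused), so that Osterwalder–Schrader's Method B (`OSSkeletonVFunctional`) — and any
other slot structure — instantiates it directly. Osterwalder–Schrader II (Comm. Math. Phys. 42
(1975)), Ch. V p. 292: "all the `T_{iμ}` analytically continue the same distribution `T` … it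
follows from the Malgrange–Zerner theorem … that there is an analytic function … analytic in the
convex envelope of the union of the flat tubes".

**Input**: a continuous, polynomially bounded function `S : ℝ^{k+1} → ℂ` of `k + 1` nonnegative
parameters and, for every slot `i`, a family `E i u' : ℂ → ℂ` (`u' ∈ ℝᵏ` the other parameters)
holomorphic on `{Re τ > 0}`, continuous in `u'`, polynomially bounded on `{Re τ ≥ 0}` uniformly in
`τ`, and agreeing with `S` on the nonnegative axis, `E i u' x = S(insertNth i x u')` for `u' ≥ 0`,
`x ≥ 0`. **Output** (`LogSlot.exists_holomorphic_extension_logDensity`): `F` holomorphic on the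
tube `{∑ᵢ |Im zᵢ| < π/2}` over the `ℓ¹`-ball, bounded on closed sub-tubes, with
`F(x) = e^{-2b∑xᵢ²} S(eˣ)` at real points — `S` is real-analytic on `(0,∞)^{k+1}` and `S(e^{z})`
continues analytically to `{∑ᵢ |Im zᵢ| < π/2} = {∑ |arg wᵢ| < π/2}`, OS's (5.8). The proof is that
of the two files named, with the slot functions abstracted (`logT`, Fubini per slot, the dominated
holomorphic parameter integral `slotInt`, the flat tube theorem
`Literature.Analysis.Complex.exists_holomorphic_extension_l1Tube`, `logDensity`).

## References

* K. Osterwalder, R. Schrader, *Axioms for Euclidean Green's functions II*, Comm. Math. Phys.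
  42 (1975) 281–305, Ch. V pp. 289–292, (5.7)–(5.8). [OsterwalderSchraderCMP1975]
-/

noncomputable section

open MeasureTheory Set Filter Real
open _root_.Topology
open scoped NNReal SchwartzMap ContDiff

namespace Literature.MathematicalPhysics.QuantumFieldTheory.LogSlot

/-! ### The functional -/

section Functional

variable {k : ℕ} (S : (Fin (k + 1) → ℝ) → ℂ) (b : ℝ)

/-- The **functional** `T(θ) = ∫ (∏ᵢ logW b θᵢ (uᵢ)) S(u) du`. [cite: OsterwalderSchraderCMP1975, Ch. V p. 292] -/
def logT (θ : Fin (k + 1) → ℝ → ℂ) : ℂ := ∫ u : Fin (k + 1) → ℝ, wprod b θ u * S u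

variable {S b}

/-- The integrand of the functional is integrable for Schwartz profiles. [folklore] -/
theorem integrable_wprod_mul (hb : 0 < b) (hSc : Continuous S) {C : ℝ} {N : ℕ}
    (hSb : ∀ u, ‖S u‖ ≤ C * (1 + ‖u‖) ^ N) (θ : Fin (k + 1) → 𝓢(ℝ, ℂ)) :
    Integrable fun u : Fin (k + 1) → ℝ => wprod b (fun j => ⇑(θ j)) u * S u :=
  integrable_prod_logW_mul hb θ hSc.aestronglyMeasurable hSb

/-! ### Slot `i`: Fubini -/

variable (i : Fin (k + 1))

/-- **Fubini for the slot `i`**: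
`T(θ[i ↦ ϑ]) = ∫ logW b ϑ (x) (∫ (∏ⱼ logW b θ_{σᵢ j} (u'ⱼ)) S(insertNth i x u') du') dx`. [folklore] -/
theorem logT_update_eq_integral_integral (hb : 0 < b) (hSc : Continuous S) {C : ℝ} {N : ℕ}
    (hSb : ∀ u, ‖S u‖ ≤ C * (1 + ‖u‖) ^ N) (θ : Fin (k + 1) → 𝓢(ℝ, ℂ)) (ϑ : 𝓢(ℝ, ℂ)) :
    logT S b (Function.update (fun j => ⇑(θ j)) i ϑ) =
      ∫ x : ℝ, logW b ϑ x * ∫ u' : Fin k → ℝ,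
        (∏ j, logW b (θ (i.succAbove j)) (u' j)) * S (i.insertNth x u') := by
  have hθ' : Function.update (fun j => ⇑(θ j)) i ϑ = fun j => ⇑(Function.update θ i ϑ j) := by
    funext j
    by_cases hj : j = i
    · subst hj; simp
    · simp [Function.update_of_ne hj]
  have hint : Integrable fun u : Fin (k + 1) → ℝ =>
      wprod b (Function.update (fun j => ⇑(θ j)) i ϑ) u * S u := by
    rw [hθ']
    exact integrable_wprod_mul hb hSc hSb _
  set e := MeasurableEquiv.piFinSuccAbove (fun _ : Fin (k + 1) => ℝ) i with he
  have hmp : MeasurePreserving e (volume : Measure (Fin (k + 1) → ℝ))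
      ((volume : Measure ℝ).prod (volume : Measure (Fin k → ℝ))) := by
    have h := measurePreserving_piFinSuccAbove (fun _ : Fin (k + 1) => (volume : Measure ℝ)) i
    rwa [← volume_pi, ← volume_pi] at h
  rw [logT, ← hmp.symm.integral_comp' (f := e.symm)]
  have hint' : Integrable (fun z : ℝ × (Fin k → ℝ) =>
      wprod b (Function.update (fun j => ⇑(θ j)) i ϑ) (e.symm z) * S (e.symm z))
      ((volume : Measure ℝ).prod (volume : Measure (Fin k → ℝ))) :=
    hmp.symm.integrable_comp_emb e.symm.measurableEmbedding |>.2 hint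
  have hfun : (fun z : ℝ × (Fin k → ℝ) =>
      wprod b (Function.update (fun j => ⇑(θ j)) i ϑ) (e.symm z) * S (e.symm z)) =
      fun z => logW b ϑ z.1 * ((∏ j, logW b (θ (i.succAbove j)) (z.2 j)) * S (i.insertNth z.1 z.2)) := by
    funext z
    change wprod b (Function.update (fun j => ⇑(θ j)) i ϑ) (i.insertNth z.1 z.2) * S (i.insertNth z.1 z.2) = _
    rw [wprod_update_insertNth, mul_assoc]
  rw [hfun] at hint' ⊢
  rw [integral_prod _ hint']
  refine integral_congr_ae (Eventually.of_forall fun x => ?_)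
  exact integral_const_mul (logW b ϑ x) _

end Functional

/-! ### The integrated slot function: holomorphy and bounds -/

section SlotInt

variable {k : ℕ} (S : (Fin (k + 1) → ℝ) → ℂ) (E : (Fin k → ℝ) → ℂ → ℂ) (i : Fin (k + 1)) (b : ℝ)

/-- The **integrated slot function** `Qᵢ(τ) = ∫ (∏ⱼ logW b θ_{σᵢ j}(u'ⱼ)) E(u', τ) du'`. [cite: OsterwalderSchraderCMP1975, Ch. V eqs. (5.4), (5.7)] -/
def slotInt (θ : Fin (k + 1) → ℝ → ℂ) (τ : ℂ) : ℂ :=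
  ∫ u' : Fin k → ℝ, (∏ j, logW b (θ (i.succAbove j)) (u' j)) * E u' τ

/-- The **slot bound** `Bᵢ(θ) = ∫ (∏ⱼ ‖logW b θ_{σᵢ j}(u'ⱼ)‖) C (1 + ‖u'‖)ᴺ du'`. [folklore] -/
def slotB (C : ℝ) (N : ℕ) (θ : Fin (k + 1) → ℝ → ℂ) : ℝ :=
  ∫ u' : Fin k → ℝ, (∏ j, ‖logW b (θ (i.succAbove j)) (u' j)‖) * (C * (1 + ‖u'‖) ^ N)

variable {S E i b}

/-- **The inner integral of the Fubini split is the integrated slot function at real points**: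
for `x ≥ 0`, if `E u' x = S(insertNth i x u')` for `u' ≥ 0`. [folklore] -/
theorem integral_prod_logW_mul_eq_slotInt (hES : ∀ u' : Fin k → ℝ, (∀ j, 0 ≤ u' j) → ∀ x : ℝ, 0 ≤ x →
      E u' x = S (i.insertNth x u')) (θ : Fin (k + 1) → ℝ → ℂ) {x : ℝ} (hx : 0 ≤ x) :
    ∫ u' : Fin k → ℝ, (∏ j, logW b (θ (i.succAbove j)) (u' j)) * S (i.insertNth x u') =
      slotInt E i b θ x := by
  rw [slotInt]
  refine integral_congr_ae (Eventually.of_forall fun u' => ?_)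
  by_cases hu : ∀ j, 0 < u' j
  · simp only
    rw [hES u' (fun j => (hu j).le) x hx]
  · push Not at hu
    obtain ⟨j, hj⟩ := hu
    have h0 : ∏ j, logW b (θ (i.succAbove j)) (u' j) = 0 :=
      Finset.prod_eq_zero (Finset.mem_univ j) (logW_of_nonpos hj)
    simp only [h0, zero_mul]

/-- **Domination**: integrability of `u' ↦ (∏ⱼ ‖logW b θ_{σᵢ j} (u'ⱼ)‖) C (1 + ‖u'‖)ᴺ`. [folklore] -/
theorem integrable_prod_norm_logW_mul_pow (hb : 0 < b) (θ : Fin (k + 1) → 𝓢(ℝ, ℂ)) {C : ℝ} (hC : 0 ≤ C)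
    (N : ℕ) :
    Integrable fun u' : Fin k → ℝ =>
      (∏ j, ‖logW b (θ (i.succAbove j)) (u' j)‖) * (C * (1 + ‖u'‖) ^ N) := by
  have hM : ∀ j, ∃ M, ∀ s, ‖θ j s‖ ≤ M := fun j =>
    ⟨SchwartzMap.seminorm ℂ 0 0 (θ j), fun s => SchwartzMap.norm_le_seminorm ℂ (θ j) s⟩
  choose M hM using hM
  have hint : Integrable fun u' : Fin k → ℝ => ∏ j, (‖logW b (θ (i.succAbove j)) (u' j)‖ * (1 + |u' j|) ^ N) :=
    Integrable.fintype_prod (f := fun j (x : ℝ) => ‖logW b (θ (i.succAbove j)) x‖ * (1 + |x|) ^ N)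
      fun j => integrable_norm_logW_mul_pow hb (θ _).continuous (hM _) N
  have hmeas : Measurable fun u' : Fin k → ℝ => ∏ j, ‖logW b (θ (i.succAbove j)) (u' j)‖ :=
    Finset.measurable_prod _ fun j _ =>
      ((measurable_logW (θ _).continuous).comp (measurable_pi_apply j)).norm
  refine (hint.const_mul C).mono' ?_ (Eventually.of_forall fun u' => ?_)
  · exact (hmeas.mul (measurable_const.mul ((measurable_const.add measurable_norm).pow_const N))).aestronglyMeasurable
  rw [Real.norm_eq_abs, abs_of_nonneg (mul_nonneg (Finset.prod_nonneg fun j _ => norm_nonneg _) (by positivity))]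
  have h1 : (1 + ‖u'‖) ^ N ≤ ∏ j, (1 + |u' j|) ^ N := Literature.Analysis.Complex.one_add_norm_pow_le_prod u' N
  calc (∏ j, ‖logW b (θ (i.succAbove j)) (u' j)‖) * (C * (1 + ‖u'‖) ^ N)
      ≤ (∏ j, ‖logW b (θ (i.succAbove j)) (u' j)‖) * (C * ∏ j, (1 + |u' j|) ^ N) := by gcongr
    _ = C * ∏ j, (‖logW b (θ (i.succAbove j)) (u' j)‖ * (1 + |u' j|) ^ N) := by
        rw [Finset.prod_mul_distrib]; ring

/-- Measurability of the slot integrand in the other parameters. [folklore] -/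
theorem aestronglyMeasurable_slot_integrand (hEc : ∀ τ, Continuous fun u' => E u' τ)
    (θ : Fin (k + 1) → 𝓢(ℝ, ℂ)) (τ : ℂ) :
    AEStronglyMeasurable (fun u' : Fin k → ℝ => (∏ j, logW b (θ (i.succAbove j)) (u' j)) * E u' τ) volume := by
  have hmeas : Measurable fun u' : Fin k → ℝ => ∏ j, logW b (θ (i.succAbove j)) (u' j) :=
    Finset.measurable_prod _ fun j _ => (measurable_logW (θ _).continuous).comp (measurable_pi_apply j)
  exact hmeas.aestronglyMeasurable.mul (hEc τ).aestronglyMeasurable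

variable {C : ℝ} {N : ℕ} (hCN : ∀ (u' : Fin k → ℝ) (τ : ℂ), 0 ≤ τ.re → ‖E u' τ‖ ≤ C * (1 + ‖u'‖) ^ N)

include hCN

/-- **Domination of the slot integrand** for `Re τ ≥ 0`. [folklore] -/
theorem norm_slot_integrand_le (θ : Fin (k + 1) → ℝ → ℂ) {τ : ℂ} (hτ : 0 ≤ τ.re) (u' : Fin k → ℝ) :
    ‖(∏ j, logW b (θ (i.succAbove j)) (u' j)) * E u' τ‖ ≤
      (∏ j, ‖logW b (θ (i.succAbove j)) (u' j)‖) * (C * (1 + ‖u'‖) ^ N) := by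
  rw [norm_mul, norm_prod]
  exact mul_le_mul_of_nonneg_left (hCN _ τ hτ) (Finset.prod_nonneg fun j _ => norm_nonneg _)

/-- **Holomorphy of the integrated slot function** on `{Re τ > 0}` (dominated holomorphic parameter
integral). [cite: OsterwalderSchraderCMP1975, Ch. V eqs. (5.4), (5.7)] -/
theorem differentiableOn_slotInt (hb : 0 < b) (hC : 0 ≤ C) (hEc : ∀ τ, Continuous fun u' => E u' τ)
    (hEd : ∀ u', DifferentiableOn ℂ (E u') {τ : ℂ | 0 < τ.re}) (θ : Fin (k + 1) → 𝓢(ℝ, ℂ)) :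
    DifferentiableOn ℂ (slotInt E i b fun j => ⇑(θ j)) {τ : ℂ | 0 < τ.re} := by
  set U : Set ℂ := {τ : ℂ | 0 < τ.re} with hU
  set F : ℂ → (Fin k → ℝ) → ℂ := fun τ u' => (∏ j, logW b (θ (i.succAbove j)) (u' j)) * E u' τ with hF
  have hslot : (slotInt E i b fun j => ⇑(θ j)) = fun τ => ∫ u', F τ u' := rfl
  rw [hslot]
  have hmeas : ∀ τ ∈ U, AEStronglyMeasurable (F τ) volume := fun τ _ =>
    aestronglyMeasurable_slot_integrand hEc θ τ
  have hdiff : ∀ᵐ u' ∂(volume : Measure (Fin k → ℝ)), DifferentiableOn ℂ (fun τ => F τ u') U :=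
    Eventually.of_forall fun u' =>
      (differentiableOn_const (∏ j, logW b (θ (i.succAbove j)) (u' j))).mul (hEd u')
  have hdom : ∀ τ₀ ∈ U, ∃ R : ℝ, 0 < R ∧ Metric.ball τ₀ R ⊆ U ∧ ∃ bound : (Fin k → ℝ) → ℝ,
      Integrable bound volume ∧ ∀ᵐ u' ∂(volume : Measure (Fin k → ℝ)), ∀ τ ∈ Metric.ball τ₀ R,
        ‖F τ u'‖ ≤ bound u' := by
    intro τ₀ hτ₀
    have hτ₀' : 0 < τ₀.re := hτ₀
    have hball : ∀ τ ∈ Metric.ball τ₀ (τ₀.re / 2), 0 < τ.re := by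
      intro τ hτ
      have h := mem_ball_iff_norm.1 hτ
      have h2 : |τ.re - τ₀.re| < τ₀.re / 2 := by
        calc |τ.re - τ₀.re| = |(τ - τ₀).re| := by simp
          _ ≤ ‖τ - τ₀‖ := Complex.abs_re_le_norm _
          _ < τ₀.re / 2 := h
      rcases abs_lt.1 h2 with ⟨h3, -⟩
      linarith
    exact ⟨τ₀.re / 2, by positivity, fun τ hτ => hball τ hτ,
      fun u' => (∏ j, ‖logW b (θ (i.succAbove j)) (u' j)‖) * (C * (1 + ‖u'‖) ^ N),
      integrable_prod_norm_logW_mul_pow hb θ hC N,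
      Eventually.of_forall fun u' τ hτ => norm_slot_integrand_le hCN (fun j => ⇑(θ j)) (hball τ hτ).le u'⟩
  exact Literature.Analysis.Complex.differentiableOn_integral_of_dominated hmeas hdiff hdom

/-- **Bound of the integrated slot function** on `{Re τ ≥ 0}`: `‖Qᵢ(τ)‖ ≤ Bᵢ(θ)`. [folklore] -/
theorem norm_slotInt_le (hb : 0 < b) (hC : 0 ≤ C) (θ : Fin (k + 1) → 𝓢(ℝ, ℂ)) {τ : ℂ} (hτ : 0 ≤ τ.re) :
    ‖slotInt E i b (fun j => ⇑(θ j)) τ‖ ≤ slotB i b C N fun j => ⇑(θ j) :=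
  norm_integral_le_of_norm_le (integrable_prod_norm_logW_mul_pow hb θ hC N)
    (Eventually.of_forall fun u' => norm_slot_integrand_le hCN (fun j => ⇑(θ j)) hτ u')

/-- **The slot function in the logarithmic variable, `gᵢ(z) = Qᵢ(eᶻ)`, is holomorphic in the strip
`{|Im z| < π/2}` and bounded by `Bᵢ(θ)` on its closure.** [cite: OsterwalderSchraderCMP1975, Ch. V p. 292] -/
theorem slot_log_holomorphic (hb : 0 < b) (hC : 0 ≤ C) (hEc : ∀ τ, Continuous fun u' => E u' τ)
    (hEd : ∀ u', DifferentiableOn ℂ (E u') {τ : ℂ | 0 < τ.re}) (θ : Fin (k + 1) → 𝓢(ℝ, ℂ)) :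
    DifferentiableOn ℂ (fun z => slotInt E i b (fun j => ⇑(θ j)) (Complex.exp z)) {z : ℂ | |z.im| < π / 2} ∧
      ∀ c : ℝ, c < π / 2 → ∀ z : ℂ, |z.im| ≤ c →
        ‖slotInt E i b (fun j => ⇑(θ j)) (Complex.exp z)‖ ≤
          slotB i b C N (fun j => ⇑(θ j)) * Real.exp (0 * |z.re|) := by
  refine ⟨(differentiableOn_slotInt hCN hb hC hEc hEd θ).comp Complex.differentiable_exp.differentiableOn
    fun z hz => exp_re_pos_of_abs_im_lt hz, fun c hc z hz => ?_⟩
  rw [zero_mul, Real.exp_zero, mul_one]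
  exact norm_slotInt_le hCN hb hC θ (exp_re_nonneg_of_abs_im_le (hz.trans hc.le))

end SlotInt

/-! ### The density form of the theorem -/

section Main

variable {k : ℕ} (S : (Fin (k + 1) → ℝ) → ℂ) (E : Fin (k + 1) → (Fin k → ℝ) → ℂ → ℂ) {b : ℝ} (hb : 0 < b)
  (hSc : Continuous S) {C₀ : ℝ} {N₀ : ℕ} (hSb : ∀ u, ‖S u‖ ≤ C₀ * (1 + ‖u‖) ^ N₀)
  (hEc : ∀ i τ, Continuous fun u' => E i u' τ)
  (hEd : ∀ i u', DifferentiableOn ℂ (E i u') {τ : ℂ | 0 < τ.re})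
  (hEb : ∀ i, ∃ (C : ℝ) (N : ℕ), 0 ≤ C ∧ ∀ (u' : Fin k → ℝ) (τ : ℂ), 0 ≤ τ.re → ‖E i u' τ‖ ≤ C * (1 + ‖u'‖) ^ N)
  (hES : ∀ i (u' : Fin k → ℝ), (∀ j, 0 ≤ u' j) → ∀ x : ℝ, 0 ≤ x → E i u' x = S (i.insertNth x u'))

include hb hSc hSb hEc hEd hEb hES

omit hEb in
/-- **The slot representations of the functional** (hypothesis `hT` of the flat tube theorem). [cite: OsterwalderSchraderCMP1975, Ch. V p. 292] -/
theorem logT_slot (i : Fin (k + 1)) {C : ℝ} {N : ℕ} (hC : 0 ≤ C)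
    (hCN : ∀ (u' : Fin k → ℝ) (τ : ℂ), 0 ≤ τ.re → ‖E i u' τ‖ ≤ C * (1 + ‖u'‖) ^ N)
    (θ : Fin (k + 1) → 𝓢(ℝ, ℂ)) :
    ∃ g : ℂ → ℂ, DifferentiableOn ℂ g {z : ℂ | |z.im| < π / 2} ∧
      (∀ c : ℝ, c < π / 2 → ∀ z : ℂ, |z.im| ≤ c →
        ‖g z‖ ≤ slotB i b C N (fun j => ⇑(θ j)) * Real.exp (0 * |z.re|)) ∧
      ∀ ϑ : 𝓢(ℝ, ℂ), logT S b (Function.update (fun j => ⇑(θ j)) i ϑ) =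
        ∫ s : ℝ, g s * Complex.exp (-(b : ℂ) * (s : ℂ) ^ 2) * ϑ s := by
  obtain ⟨hdiff, hbound⟩ := slot_log_holomorphic hCN hb hC (hEc i) (hEd i) θ
  refine ⟨_, hdiff, hbound, fun ϑ => ?_⟩
  rw [logT_update_eq_integral_integral i hb hSc hSb θ ϑ]
  have h1 : (fun x : ℝ => logW b ϑ x * ∫ u' : Fin k → ℝ, (∏ j, logW b (θ (i.succAbove j)) (u' j)) *
      S (i.insertNth x u')) =
      fun x => logW b ϑ x * slotInt (E i) i b (fun j => ⇑(θ j)) x := by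
    funext x
    rcases le_or_gt x 0 with hx | hx
    · rw [logW_of_nonpos hx, zero_mul, zero_mul]
    · rw [integral_prod_logW_mul_eq_slotInt (hES i) (fun j => ⇑(θ j)) hx.le]
  rw [h1, integral_logW_mul_eq]
  refine integral_congr_ae (Eventually.of_forall fun s => ?_)
  beta_reduce
  rw [Complex.ofReal_exp]

omit hb hSc hSb hEc hEd hEb hES in
/-- **The slot bounds at modulated Gaussians do not depend on the frequencies.** [folklore] -/
theorem slotB_gaussMod_eq (i : Fin (k + 1)) (C : ℝ) (N : ℕ) (p : Fin (k + 1) → ℝ) :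
    slotB i b C N (fun j (s : ℝ) => Complex.exp (-(b : ℂ) * (s : ℂ) ^ 2) *
        Complex.exp (↑(-2 * π * s * p j) * Complex.I)) =
      slotB i b C N (fun _ (s : ℝ) => Complex.exp (-(b : ℂ) * (s : ℂ) ^ 2)) := by
  refine integral_congr_ae (Eventually.of_forall fun u' => ?_)
  simp only [norm_logW_gaussMod]

/-- **Joint analyticity in the logarithmic variables, density form**: there is `F` holomorphic on
`{∑ᵢ |Im zᵢ| < π/2}`, bounded on closed sub-tubes, with `T(e^{-b·²}ϑ) = ∫ F(x) ∏ᵢ ϑᵢ(xᵢ) dx`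
for all Schwartz `ϑᵢ`. [cite: OsterwalderSchraderCMP1975, Ch. V pp. 291–292] -/
theorem exists_holomorphic_logT :
    ∃ F : (Fin (k + 1) → ℂ) → ℂ,
      DifferentiableOn ℂ F {z : Fin (k + 1) → ℂ | ∑ j, |(z j).im| < π / 2} ∧
      (∀ c : ℝ, c < π / 2 → ∃ K : ℝ, ∀ z : Fin (k + 1) → ℂ, ∑ j, |(z j).im| ≤ c → ‖F z‖ ≤ K) ∧
      ∀ ϑ : Fin (k + 1) → 𝓢(ℝ, ℂ),
        logT S b (fun j (s : ℝ) => Complex.exp (-(b : ℂ) * (s : ℂ) ^ 2) * ϑ j s) =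
          ∫ x : Fin (k + 1) → ℝ, F (fun j => (x j : ℂ)) * ∏ j, ϑ j (x j) := by
  choose C N hC hCN using hEb
  exact Literature.Analysis.Complex.exists_holomorphic_extension_l1Tube (a := π / 2) (by positivity) hb
    (logT S b) (fun i θ _ => slotB i b (C i) (N i) θ)
    (fun i θ => logT_slot S E hb hSc hSb hEc hEd hES i (hC i) (hCN i) θ)
    fun c _ => ⟨(Finset.univ : Finset (Fin (k + 1))).sup' Finset.univ_nonempty fun i =>
        slotB i b (C i) (N i) fun _ (s : ℝ) => Complex.exp (-(b : ℂ) * (s : ℂ) ^ 2), 0,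
      fun i p => by
        rw [slotB_gaussMod_eq, pow_zero, mul_one]
        exact Finset.le_sup' (fun i => slotB i b (C i) (N i) fun _ (s : ℝ) =>
          Complex.exp (-(b : ℂ) * (s : ℂ) ^ 2)) (Finset.mem_univ i)⟩

end Main

/-! ### The density -/

section Density

variable {k : ℕ} (S : (Fin (k + 1) → ℝ) → ℂ) (b : ℝ)

/-- The **logarithmic density** `logDensity x = e^{-2b∑ᵢ xᵢ²} S(eˣ)`. [folklore] -/
def logDensity (x : Fin (k + 1) → ℝ) : ℂ :=
  Complex.exp (-(2 * b : ℂ) * ∑ i, (x i : ℂ) ^ 2) * S (expPi x)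

variable {S b}

/-- Continuity of the logarithmic density. [folklore] -/
theorem continuous_logDensity (hSc : Continuous S) : Continuous (logDensity S b) := by
  unfold logDensity
  refine (Complex.continuous_exp.comp (continuous_const.mul (continuous_finsetSum _ fun i _ =>
    ((Complex.continuous_ofReal.comp (continuous_apply i)).pow 2)))).mul ?_
  exact hSc.comp (continuous_pi fun i => Real.continuous_exp.comp (continuous_apply i))

/-- **The functional at windowed Schwartz profiles is the integral of the logarithmic density.** [folklore] -/
theorem logT_gaussian_mul_eq_integral_logDensity (ϑ : Fin (k + 1) → 𝓢(ℝ, ℂ)) :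
    logT S b (fun j (s : ℝ) => Complex.exp (-(b : ℂ) * (s : ℂ) ^ 2) * ϑ j s) =
      ∫ x : Fin (k + 1) → ℝ, logDensity S b x * ∏ j, ϑ j (x j) := by
  rw [logT]
  have h1 : ∫ u : Fin (k + 1) → ℝ, wprod b (fun j (s : ℝ) => Complex.exp (-(b : ℂ) * (s : ℂ) ^ 2) * ϑ j s) u *
      S u = ∫ u in Set.pi univ (fun _ => Ioi (0 : ℝ)),
        wprod b (fun j (s : ℝ) => Complex.exp (-(b : ℂ) * (s : ℂ) ^ 2) * ϑ j s) u * S u := by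
    refine (setIntegral_eq_integral_of_forall_compl_eq_zero fun u hu => ?_).symm
    have hu' : ∃ i, u i ≤ 0 := by
      by_contra h
      push Not at h
      exact hu fun i _ => h i
    obtain ⟨i, hi⟩ := hu'
    rw [wprod, Finset.prod_eq_zero (Finset.mem_univ i) (logW_of_nonpos hi), zero_mul]
  rw [h1, integral_comp_exp_pi]
  refine integral_congr_ae (Eventually.of_forall fun x => ?_)
  simp only [logDensity, wprod, expPi, logW_exp, Complex.real_smul, Complex.ofReal_prod,
    Complex.ofReal_exp]
  have hfac : ∀ i, Complex.exp (x i : ℂ) * (Complex.exp (-(b : ℂ) * (x i : ℂ) ^ 2) *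
      (Complex.exp (-(b : ℂ) * (x i : ℂ) ^ 2) * ϑ i (x i)) / Complex.exp (x i : ℂ)) =
      Complex.exp (-(2 * b : ℂ) * (x i : ℂ) ^ 2) * ϑ i (x i) := by
    intro i
    have hne : Complex.exp (x i : ℂ) ≠ 0 := Complex.exp_ne_zero _
    have h2 : Complex.exp (-(2 * b : ℂ) * (x i : ℂ) ^ 2) =
        Complex.exp (-(b : ℂ) * (x i : ℂ) ^ 2) * Complex.exp (-(b : ℂ) * (x i : ℂ) ^ 2) := by
      rw [← Complex.exp_add]; congr 1; ring
    rw [h2]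
    field_simp
  calc (∏ i, Complex.exp (x i : ℂ)) * ((∏ i, Complex.exp (-(b : ℂ) * (x i : ℂ) ^ 2) *
        (Complex.exp (-(b : ℂ) * (x i : ℂ) ^ 2) * ϑ i (x i)) / Complex.exp (x i : ℂ)) *
        S fun i => Real.exp (x i))
      = (∏ i, Complex.exp (x i : ℂ) * (Complex.exp (-(b : ℂ) * (x i : ℂ) ^ 2) *
        (Complex.exp (-(b : ℂ) * (x i : ℂ) ^ 2) * ϑ i (x i)) / Complex.exp (x i : ℂ))) *
        S fun i => Real.exp (x i) := by rw [Finset.prod_mul_distrib]; ring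
    _ = (∏ i, Complex.exp (-(2 * b : ℂ) * (x i : ℂ) ^ 2) * ϑ i (x i)) * S fun i => Real.exp (x i) := by
        simp_rw [hfac]
    _ = Complex.exp (-(2 * b : ℂ) * ∑ i, (x i : ℂ) ^ 2) * (S fun i => Real.exp (x i)) *
        ∏ j, ϑ j (x j) := by
        rw [Finset.prod_mul_distrib, Finset.mul_sum, Complex.exp_sum]; ring

end Density

/-! ### The pointwise theorem -/

section Pointwise

variable {k : ℕ} (S : (Fin (k + 1) → ℝ) → ℂ) (E : Fin (k + 1) → (Fin k → ℝ) → ℂ → ℂ) {b : ℝ} (hb : 0 < b)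
  (hSc : Continuous S) {C₀ : ℝ} {N₀ : ℕ} (hSb : ∀ u, ‖S u‖ ≤ C₀ * (1 + ‖u‖) ^ N₀)
  (hEc : ∀ i τ, Continuous fun u' => E i u' τ)
  (hEd : ∀ i u', DifferentiableOn ℂ (E i u') {τ : ℂ | 0 < τ.re})
  (hEb : ∀ i, ∃ (C : ℝ) (N : ℕ), 0 ≤ C ∧ ∀ (u' : Fin k → ℝ) (τ : ℂ), 0 ≤ τ.re → ‖E i u' τ‖ ≤ C * (1 + ‖u'‖) ^ N)
  (hES : ∀ i (u' : Fin k → ℝ), (∀ j, 0 ≤ u' j) → ∀ x : ℝ, 0 ≤ x → E i u' x = S (i.insertNth x u'))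

include hb hSc hSb hEc hEd hEb hES

/-- **Joint analyticity in the logarithmic variables from holomorphic slots** (the generic
Osterwalder–Schrader engine): there is `F` holomorphic on `{∑ᵢ |Im zᵢ| < π/2}`, bounded on every
closed sub-tube, with `F(x) = e^{-2b∑xᵢ²} S(eˣ)` at real points. [cite: OsterwalderSchraderCMP1975, Ch. V eqs. (5.7)–(5.8)] -/
theorem exists_holomorphic_extension_logDensity :
    ∃ F : (Fin (k + 1) → ℂ) → ℂ,
      DifferentiableOn ℂ F {z : Fin (k + 1) → ℂ | ∑ j, |(z j).im| < π / 2} ∧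
      (∀ c : ℝ, c < π / 2 → ∃ K : ℝ, ∀ z : Fin (k + 1) → ℂ, ∑ j, |(z j).im| ≤ c → ‖F z‖ ≤ K) ∧
      ∀ x : Fin (k + 1) → ℝ, F (fun j => (x j : ℂ)) = logDensity S b x := by
  obtain ⟨F, hF, hK, hT⟩ := exists_holomorphic_logT S E hb hSc hSb hEc hEd hEb hES
  refine ⟨F, hF, hK, fun x₀ => ?_⟩
  set ι : (Fin (k + 1) → ℝ) → (Fin (k + 1) → ℂ) := fun x j => (x j : ℂ) with hι
  have hιc : Continuous ι := continuous_pi fun j => Complex.continuous_ofReal.comp (continuous_apply j)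
  have hιmem : ∀ x, ι x ∈ {z : Fin (k + 1) → ℂ | ∑ j, |(z j).im| < π / 2} := fun x => by
    simp only [hι, mem_setOf_eq, Complex.ofReal_im, abs_zero, Finset.sum_const_zero]
    positivity
  have hFc : Continuous fun x => F (ι x) := hF.continuousOn.comp_continuous hιc hιmem
  obtain ⟨K, hK0⟩ := hK 0 (by positivity)
  have hFb : ∀ x, ‖F (ι x)‖ ≤ |K| * (1 + ‖x‖) ^ 0 := fun x => by
    rw [pow_zero, mul_one]
    refine (hK0 _ ?_).trans (le_abs_self K)
    simp [hι]
  have hC0' : ∀ u, ‖S u‖ ≤ |C₀| * (1 + ‖u‖) ^ N₀ := fun u =>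
    (hSb u).trans (mul_le_mul_of_nonneg_right (le_abs_self _) (by positivity))
  have hDb : ∀ x, ‖logDensity S b x‖ ≤
      |C₀| * (2 : ℝ) ^ N₀ * Real.exp (((N₀ : ℝ)) ^ 2 / (4 * (2 * b))) * (1 + ‖x‖) ^ 0 := by
    intro x
    rw [pow_zero, mul_one, logDensity, norm_mul, Complex.norm_exp]
    have hre : (-(2 * b : ℂ) * ∑ i, (x i : ℂ) ^ 2).re = -(2 * b) * ∑ i, (x i) ^ 2 := by
      have : (-(2 * b : ℂ) * ∑ i, (x i : ℂ) ^ 2) = ((-(2 * b) * ∑ i, (x i) ^ 2 : ℝ) : ℂ) := by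
        push_cast; ring
      rw [this, Complex.ofReal_re]
    rw [hre]
    refine (mul_le_mul_of_nonneg_left (hC0' (expPi x)) (Real.exp_pos _).le).trans ?_
    have hE : ‖expPi x‖ ≤ Real.exp ‖x‖ := by
      refine (pi_norm_le_iff_of_nonneg (Real.exp_pos _).le).2 fun i => ?_
      rw [expPi, Real.norm_eq_abs, abs_of_pos (Real.exp_pos _)]
      exact Real.exp_le_exp.2 ((le_abs_self _).trans (by rw [← Real.norm_eq_abs]; exact norm_le_pi_norm x i))
    have hsum : ‖x‖ ^ 2 ≤ ∑ i, (x i) ^ 2 := by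
      obtain ⟨i, -, hi⟩ := Finset.exists_max_image Finset.univ (fun i => |x i|) Finset.univ_nonempty
      have hxi : ‖x‖ ≤ |x i| := (pi_norm_le_iff_of_nonneg (abs_nonneg _)).2 fun j => by
        rw [Real.norm_eq_abs]; exact hi j (Finset.mem_univ j)
      calc ‖x‖ ^ 2 ≤ |x i| ^ 2 := pow_le_pow_left₀ (norm_nonneg _) hxi 2
        _ = x i ^ 2 := sq_abs _
        _ ≤ ∑ j, x j ^ 2 := Finset.single_le_sum (f := fun j => x j ^ 2) (fun j _ => sq_nonneg _)
            (Finset.mem_univ i)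
    have h1 : Real.exp (-(2 * b) * ∑ i, x i ^ 2) ≤ Real.exp (-(2 * b) * ‖x‖ ^ 2) :=
      Real.exp_le_exp.2 (by nlinarith)
    have h2 : (1 + ‖expPi x‖) ^ N₀ ≤ (2 : ℝ) ^ N₀ * Real.exp ((N₀ : ℝ) * ‖x‖) := by
      have h3 : 1 + ‖expPi x‖ ≤ 2 * Real.exp ‖x‖ := by
        have := Real.one_le_exp (norm_nonneg x); linarith
      calc (1 + ‖expPi x‖) ^ N₀ ≤ (2 * Real.exp ‖x‖) ^ N₀ := pow_le_pow_left₀ (by positivity) h3 N₀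
        _ = (2 : ℝ) ^ N₀ * Real.exp ((N₀ : ℝ) * ‖x‖) := by
            rw [mul_pow, ← Real.exp_nat_mul]
    have h4 := exp_neg_mul_sq_mul_exp_le (by positivity : 0 < 2 * b) (N₀ : ℝ) ‖x‖
    calc Real.exp (-(2 * b) * ∑ i, x i ^ 2) * (|C₀| * (1 + ‖expPi x‖) ^ N₀)
        ≤ Real.exp (-(2 * b) * ‖x‖ ^ 2) * (|C₀| * ((2 : ℝ) ^ N₀ * Real.exp ((N₀ : ℝ) * ‖x‖))) := by gcongr
      _ = |C₀| * (2 : ℝ) ^ N₀ * (Real.exp (-(2 * b) * ‖x‖ ^ 2) * Real.exp ((N₀ : ℝ) * ‖x‖)) := by ring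
      _ ≤ |C₀| * (2 : ℝ) ^ N₀ * Real.exp ((N₀ : ℝ) ^ 2 / (4 * (2 * b))) := by gcongr
  have hdiff : ∀ ϑ : Fin (k + 1) → 𝓢(ℝ, ℂ),
      ∫ x : Fin (k + 1) → ℝ, (F (ι x) - logDensity S b x) * ∏ i, ϑ i (x i) = 0 := by
    intro ϑ
    have hi1 := Literature.Analysis.Complex.integrable_mul_prod_schwartz hFc hFb ϑ
    have hi2 := Literature.Analysis.Complex.integrable_mul_prod_schwartz (continuous_logDensity hSc) hDb ϑ
    simp_rw [sub_mul]
    rw [integral_sub hi1 hi2, ← hT ϑ, logT_gaussian_mul_eq_integral_logDensity, sub_self]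
  have h := eq_zero_of_forall_integral_mul_prod_schwartz_eq_zero (hFc.sub (continuous_logDensity hSc)) hdiff x₀
  exact sub_eq_zero.1 h

end Pointwise

end Literature.MathematicalPhysics.QuantumFieldTheory.LogSlot
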